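/-
Copyright: statement-level skeleton of a published paper (lit-balaban cell, Phase-2 proof seat p19, gen 2). No claims beyond
what the kernel checks below.
-/
import Mathlib


/-!
# B3 — T. Bałaban, *(Higgs)₂,₃ quantum fields in a finite volume. III. Renormalization*, CMP **88** (1983) 411–445
[Balaban1983Higgs3] — Sect. 2, pp. 425–428: the shrinking bookkeeping of the proof of (2.15)/(2.16) (the subgraphs
`G_i`, the quotient graphs `G/G_i`, their degrees, and the weight (2.14) of a quotient graph)

statement-level skeleton of published theorems with citation tags; proofs where landed; nothing here is a claim about
the Yang–Mills mass gap

PDF held: `paper:balaban1983-higgs-2-3-quantum-fields-finite-volume` (journal page = PDF page + 410); displays read on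
the ×2 renders `pub-balaban/b2b-balaban-ref1/pages/1983-cmp88-higgs23-III/1983-cmp88-higgs23-III-p014 … p018-x2.png`
(pp. 424–428).

WHAT IS REPRODUCED.  Part of the Phase-2 proof of SKELETON rows **B3.Eq2.15-2.16** (unit `lit-balaban-p19` gen 2, HOME `run/shared/lean/pub/lit-balaban/`): files `B3Ineq215CubeGeometry` → `B3Ineq215DecaySum`, `B3Ineq215Quotient` → `B3Ineq215Degrees` → `B3Ineq215Reroute` → `B3Ineq215Step` → `B3Ineq215Proof` (the theorem `Model.ineq215`), all in the sub-namespace `…Balaban1983to89.B3Ineq215`; the rows were typed by r15 in `B3Sect2FirstEstimate`.  This file and `B3Ineq215Degrees`:  In the generality of **Proposition 2.2** p. 428 (*"We can have vertices with an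
arbitrary number of legs and arbitrary power of η. We can have lines with the same exponential factors but with
arbitrary dimensions instead of −d+2"*): a graph is a finite vertex type `V`, lines `Fin m` LISTED IN THE ORDER l̃ =
(l(1), …, l(m)) of (2.7) p. 424 (line `⟨i, _⟩` = l(i+1)), endpoints `src`, `tgt`, a real η-power `e v` per vertex (the
*"proper power of L^{j(v)}η"* of (2.14)) and a real dimension `a l` per line (the sum of the dimensions of its two
legs and of the differentiations acting on it, (2.1)/(2.14)); `d`, `L`, `δ₀ = ½δ₁`.
* p. 425: *"G₁ is formed by the line l(1) and two vertices at the endpoints of this line, …, G_{i+1} is built by adding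
  to the graph G_i the line l(i+1) and two vertices at the endpoints of l(i+1)"*; p. 428: *"A graph G/G_i is defined as a
  graph obtained from G by shrinking all connected components G_i^{(α)} of G_i to points."* — `rep i : V → V` sends a
  vertex to the representative of its connected component in `G_i` (recursively: contracting l(i+1) merges the block of
  its second endpoint into the block of its first), `reps i` = the vertices of `G/G_i`, `fiber`, `before` (the lines of
  a block), `Nontriv` (the block is a component of `G_i`, not an untouched vertex), `remAt`/`low` (*"j(v) = a lowest
  index of the lines with an end in this vertex"* p. 426, for the quotient vertex; `k` if none).
* (2.2) p. 423 for a component: `D i b = Σ_{v ∈ block}(d + e_v) − d + Σ_{lines of the block} a_l`, and the exponent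
  `Σ_α D(G_i^{(α)})` of (2.16): `Dsum i`.  KERNEL-CHECKED: the bookkeeping identity behind *"the remaining powers of
  L^jη connected with the graph G₁ give us (L^jη)^{D(G₁)}"* (p. 427) in its inductive form — `Dsum_succ`: contracting
  l(i+1) raises `Σ_α D` by `a_{l(i+1)} + e(b_s) + [d + e(b_t) if the endpoints lie in different blocks]`, where `e(b)`
  is the η-power of an untouched vertex and `0` for a component (`eAt`).
* (2.14) p. 427 for the quotient graph `G/G_i` at stage `i` with decay rate `δ_i = δ₀/(2m+1)^i` (*"an exponent δ_{i+1} in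
  the exponential factors on the right side is positive and depends on δ₁, n̄"*): vertex factors `VF`, line powers
  `LP`, exponential factors `EXP`, localizations `Locs` (*"cubes Δ(v) of the size L^{j(v)}η"*, `Δ(v) ⊂ □(v)`, on the
  concrete cubes of file 1/3), and the weight sum `W i k j □ = Σ_{{Δ(v)}} Ẽ(G/G_i(j), {Δ(v)})`.
Nothing of the paper is asserted here; the estimates are in `B3Ineq215Reroute`/`Step`/`Proof`.
-/


open Finset

namespace Literature.MathematicalPhysics.QuantumFieldTheory.Balaban1983to89.B3Ineq215

/-- The data of a generalized graph of Proposition 2.2 p. 428 [PDF 18] together with the constants: lines `Fin m` in the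
order l̃ of (2.7), endpoints, the η-power `e v` of each vertex and the dimension `a l` of each line ((2.1) p. 422 /
(2.14) p. 427), the dimension `d ≥ 1`, the block size `L ≥ 2` and the decay rate `δ₀ > 0` (= ½δ₁ of (2.14)).
[cite: Balaban1983Higgs3, Prop. 2.2 p.428] -/
structure Model (V : Type) [Fintype V] [DecidableEq V] (m : ℕ) where
  /-- first endpoint of the line l(i+1) -/
  src : Fin m → V
  /-- second endpoint of the line l(i+1) -/
  tgt : Fin m → V
  /-- the "proper power of L^{j(v)}η" of the vertex (2.14) -/
  e : V → ℝ
  /-- the total dimension carried by the line: its two legs and the differentiations acting on it (2.1)/(2.14) -/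
  a : Fin m → ℝ
  /-- dimension -/
  d : ℕ
  /-- block size -/
  L : ℕ
  /-- decay rate of the line factors of (2.14) (½δ₁) -/
  δ₀ : ℝ
  d_pos : 0 < d
  two_le_L : 2 ≤ L
  δ₀_pos : 0 < δ₀

namespace Model

variable {V : Type} [Fintype V] [DecidableEq V] {m : ℕ} (M : Model V m)

/-- `L > 0`. [cite: Balaban1983Higgs3, (2.14) p.427] -/
theorem L_pos : 0 < M.L := lt_of_lt_of_le two_pos M.two_le_L

/-- `L > 1` (real). [cite: Balaban1983Higgs3, (2.14) p.427] -/
theorem one_lt_L : (1 : ℝ) < M.L := by exact_mod_cast lt_of_lt_of_le one_lt_two M.two_le_L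

/-- `L > 0` (real). [cite: Balaban1983Higgs3, (2.14) p.427] -/
theorem L_pos_real : (0 : ℝ) < M.L := by exact_mod_cast M.L_pos

/-! ## The scales `L^jη`, `η = L^{−k}` -/

/-- `L^tη` with `η = L^{−k}` ((2.10) p. 426: the length scale of index `t`; `L^kη = 1`).
[cite: Balaban1983Higgs3, (2.10) p.426] -/
noncomputable def sc (k t : ℕ) : ℝ := (M.L : ℝ) ^ t * ((M.L : ℝ) ^ k)⁻¹

/-- Scales are positive. [cite: Balaban1983Higgs3, (2.10) p.426] -/
theorem sc_pos (k t : ℕ) : 0 < M.sc k t := by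
  unfold sc; have := M.L_pos_real; positivity

/-- `L^kη = 1`. [cite: Balaban1983Higgs3, (2.10) p.426] -/
theorem sc_self (k : ℕ) : M.sc k k = 1 := by
  unfold sc; exact mul_inv_cancel₀ (pow_ne_zero _ M.L_pos_real.ne')

/-- Scales increase with the index. [cite: Balaban1983Higgs3, (2.10) p.426] -/
theorem sc_le_sc (k : ℕ) {t u : ℕ} (h : t ≤ u) : M.sc k t ≤ M.sc k u :=
  mul_le_mul_of_nonneg_right (pow_le_pow_right₀ M.one_lt_L.le h) (inv_nonneg.2 (pow_nonneg M.L_pos_real.le _))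

/-- Scales below the unit scale are `≤ 1`. [cite: Balaban1983Higgs3, (2.10) p.426] -/
theorem sc_le_one {k t : ℕ} (h : t ≤ k) : M.sc k t ≤ 1 := by
  rw [← M.sc_self k]; exact M.sc_le_sc k h

/-- Ratio of two scales: `L^uη / L^tη = L^{u−t}`. [cite: Balaban1983Higgs3, (2.10) p.426] -/
theorem sc_div_sc (k : ℕ) {t u : ℕ} (h : t ≤ u) : M.sc k u / M.sc k t = (M.L : ℝ) ^ (u - t) := by
  unfold sc
  have hL := M.L_pos_real
  rw [mul_div_mul_right _ _ (inv_ne_zero (pow_ne_zero _ hL.ne')), pow_sub₀ _ hL.ne' h, div_eq_mul_inv]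

/-! ## The subgraphs `G_i` and the quotient graphs `G/G_i` (p. 425, p. 428) -/

/-- p. 425 / p. 428: the representative of the connected component of `v` in `G_i` (a vertex of `G/G_i`): `G₀` has no
lines; contracting the line l(i+1) merges the block of its second endpoint into the block of its first endpoint.
[cite: Balaban1983Higgs3, (2.16) p.428] -/
def rep : ℕ → V → V
  | 0 => id
  | i + 1 => fun v =>
      if h : i < m then
        (if rep i v = rep i (M.tgt ⟨i, h⟩) then rep i (M.src ⟨i, h⟩) else rep i v)
      else rep i v

/-- `G₀`: every vertex is its own block. [cite: Balaban1983Higgs3, (2.16) p.428] -/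
@[simp] theorem rep_zero (v : V) : M.rep 0 v = v := rfl

/-- The block of the first endpoint of l(i+1) in `G/G_i` (the vertex kept after shrinking l(i+1)).
[cite: Balaban1983Higgs3, (2.16) p.428] -/
def bs (i : ℕ) (h : i < m) : V := M.rep i (M.src ⟨i, h⟩)

/-- The block of the second endpoint of l(i+1) in `G/G_i` (the vertex summed out when shrinking l(i+1); equal to `bs` in
*"the case v = v′"* p. 428). [cite: Balaban1983Higgs3, (2.16) p.428] -/
def bt (i : ℕ) (h : i < m) : V := M.rep i (M.tgt ⟨i, h⟩)

/-- The shrinking map on the vertices of `G/G_i`: `b_t ↦ b_s`, identity otherwise. [cite: Balaban1983Higgs3, (2.16) p.428] -/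
def rho (i : ℕ) (h : i < m) (x : V) : V := if x = M.bt i h then M.bs i h else x

/-- Unfolding of the recursion (step `i < m`). [cite: Balaban1983Higgs3, (2.16) p.428] -/
theorem rep_succ {i : ℕ} (h : i < m) (v : V) : M.rep (i + 1) v = M.rho i h (M.rep i v) := by
  show (if h : i < m then _ else _) = _
  rw [dif_pos h]; rfl

/-- Beyond the last line nothing changes. [cite: Balaban1983Higgs3, (2.16) p.428] -/
theorem rep_succ_of_not_lt {i : ℕ} (h : ¬ i < m) (v : V) : M.rep (i + 1) v = M.rep i v := by
  show (if h : i < m then _ else _) = _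
  rw [dif_neg h]

/-- `ρ(b_t) = b_s`. [cite: Balaban1983Higgs3, (2.16) p.428] -/
theorem rho_bt {i : ℕ} (h : i < m) : M.rho i h (M.bt i h) = M.bs i h := by simp [rho]

/-- `ρ` fixes everything else. [cite: Balaban1983Higgs3, (2.16) p.428] -/
theorem rho_of_ne {i : ℕ} (h : i < m) {x : V} (hx : x ≠ M.bt i h) : M.rho i h x = x := by simp [rho, hx]

/-- `ρ(b_s) = b_s`. [cite: Balaban1983Higgs3, (2.16) p.428] -/
theorem rho_bs {i : ℕ} (h : i < m) : M.rho i h (M.bs i h) = M.bs i h := by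
  unfold rho; split_ifs with h' <;> [exact h'.symm ▸ rfl; rfl]

/-- `ρ` never takes the value `b_t` when `b_s ≠ b_t`. [cite: Balaban1983Higgs3, (2.16) p.428] -/
theorem rho_ne_bt {i : ℕ} (h : i < m) (hne : M.bs i h ≠ M.bt i h) (x : V) : M.rho i h x ≠ M.bt i h := by
  unfold rho; split_ifs with h' <;> [exact hne; exact h']

/-- In the case `b_s = b_t` (a loop of `G/G_i`), `ρ` is the identity. [cite: Balaban1983Higgs3, (2.16) p.428] -/
theorem rho_of_loop {i : ℕ} (h : i < m) (heq : M.bs i h = M.bt i h) (x : V) : M.rho i h x = x := by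
  unfold rho; split_ifs with h' <;> [exact heq.trans h'.symm; rfl]

/-- `rep i` is idempotent (representatives are fixed). [cite: Balaban1983Higgs3, (2.16) p.428] -/
theorem rep_idem : ∀ (i : ℕ) (v : V), M.rep i (M.rep i v) = M.rep i v
  | 0, v => rfl
  | i + 1, v => by
      by_cases h : i < m
      · have key : M.rep i (M.rho i h (M.rep i v)) = M.rho i h (M.rep i v) := by
          unfold rho
          split_ifs with h'
          · exact rep_idem i _
          · exact rep_idem i v
        rw [M.rep_succ h v, M.rep_succ h (M.rho i h (M.rep i v)), key]
        generalize M.rep i v = x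
        unfold rho
        by_cases hx : x = M.bt i h
        · simp only [hx, if_true]; split_ifs <;> rfl
        · simp [hx]
      · rw [M.rep_succ_of_not_lt h, M.rep_succ_of_not_lt h, rep_idem i v]

/-- `b_s` is a representative at stage `i`. [cite: Balaban1983Higgs3, (2.16) p.428] -/
theorem rep_bs {i : ℕ} (h : i < m) : M.rep i (M.bs i h) = M.bs i h := M.rep_idem i _

/-- `b_t` is a representative at stage `i`. [cite: Balaban1983Higgs3, (2.16) p.428] -/
theorem rep_bt {i : ℕ} (h : i < m) : M.rep i (M.bt i h) = M.bt i h := M.rep_idem i _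

/-- After shrinking l(i+1) both its endpoints lie in the block `b_s`. [cite: Balaban1983Higgs3, (2.16) p.428] -/
theorem rep_succ_src {i : ℕ} (h : i < m) : M.rep (i + 1) (M.src ⟨i, h⟩) = M.bs i h := by
  rw [M.rep_succ h]; exact M.rho_bs h

/-- After shrinking l(i+1) both its endpoints lie in the block `b_s`. [cite: Balaban1983Higgs3, (2.16) p.428] -/
theorem rep_succ_tgt {i : ℕ} (h : i < m) : M.rep (i + 1) (M.tgt ⟨i, h⟩) = M.bs i h := by
  rw [M.rep_succ h]; exact M.rho_bt h

/-- `rep (i+1) b_s = b_s`. [cite: Balaban1983Higgs3, (2.16) p.428] -/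
theorem rep_succ_bs {i : ℕ} (h : i < m) : M.rep (i + 1) (M.bs i h) = M.bs i h := by
  rw [M.rep_succ h, M.rep_bs h]; exact M.rho_bs h

/-- `rep (i+1) b_t = b_s`. [cite: Balaban1983Higgs3, (2.16) p.428] -/
theorem rep_succ_bt {i : ℕ} (h : i < m) : M.rep (i + 1) (M.bt i h) = M.bs i h := by
  rw [M.rep_succ h, M.rep_bt h]; exact M.rho_bt h

/-- In the loop case the blocks do not change. [cite: Balaban1983Higgs3, (2.16) p.428] -/
theorem rep_succ_of_loop {i : ℕ} (h : i < m) (heq : M.bs i h = M.bt i h) (v : V) : M.rep (i + 1) v = M.rep i v := by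
  rw [M.rep_succ h, M.rho_of_loop h heq]

/-- Blocks only merge: equal representatives stay equal at all later stages. [cite: Balaban1983Higgs3, (2.16) p.428] -/
theorem rep_eq_of_le {i i' : ℕ} (hle : i ≤ i') {u v : V} (huv : M.rep i u = M.rep i v) : M.rep i' u = M.rep i' v := by
  induction i', hle using Nat.le_induction with
  | base => exact huv
  | succ n _ ih =>
      by_cases h : n < m
      · rw [M.rep_succ h, M.rep_succ h, ih]
      · rw [M.rep_succ_of_not_lt h, M.rep_succ_of_not_lt h, ih]

/-- A later stage's representative of an earlier representative. [cite: Balaban1983Higgs3, (2.16) p.428] -/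
theorem rep_rep_of_le {i i' : ℕ} (hle : i ≤ i') (v : V) : M.rep i' (M.rep i v) = M.rep i' v :=
  M.rep_eq_of_le hle (M.rep_idem i v)

/-- The two endpoints of a line of `G_i` (a line l(t+1), `t < i`) lie in the same block of `G_i`.
[cite: Balaban1983Higgs3, (2.16) p.428] -/
theorem rep_src_eq_rep_tgt {i : ℕ} {l : Fin m} (hl : (l : ℕ) < i) : M.rep i (M.src l) = M.rep i (M.tgt l) := by
  have h := l.isLt
  have e : M.rep ((l : ℕ) + 1) (M.src l) = M.rep ((l : ℕ) + 1) (M.tgt l) := by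
    have := M.rep_succ_src h
    have := M.rep_succ_tgt h
    simp_all
  exact M.rep_eq_of_le (Nat.succ_le_of_lt hl) e

/-! ## The vertices of `G/G_i`, its lines at a vertex, the lowest index `j(v)` -/

/-- The vertices of `G/G_i` (representatives of the blocks). [cite: Balaban1983Higgs3, (2.16) p.428] -/
def reps (i : ℕ) : Finset V := univ.filter fun b => M.rep i b = b

/-- Membership in `reps`. [cite: Balaban1983Higgs3, (2.16) p.428] -/
theorem mem_reps {i : ℕ} {b : V} : b ∈ M.reps i ↔ M.rep i b = b := by simp [reps]

/-- Every representative is a vertex of `G/G_i`. [cite: Balaban1983Higgs3, (2.16) p.428] -/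
theorem rep_mem_reps (i : ℕ) (v : V) : M.rep i v ∈ M.reps i := M.mem_reps.2 (M.rep_idem i v)

/-- `b_s ∈ reps i`. [cite: Balaban1983Higgs3, (2.16) p.428] -/
theorem bs_mem_reps {i : ℕ} (h : i < m) : M.bs i h ∈ M.reps i := M.rep_mem_reps i _

/-- `b_t ∈ reps i`. [cite: Balaban1983Higgs3, (2.16) p.428] -/
theorem bt_mem_reps {i : ℕ} (h : i < m) : M.bt i h ∈ M.reps i := M.rep_mem_reps i _

/-- `b_s ∈ reps (i+1)`. [cite: Balaban1983Higgs3, (2.16) p.428] -/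
theorem bs_mem_reps_succ {i : ℕ} (h : i < m) : M.bs i h ∈ M.reps (i + 1) := M.mem_reps.2 (M.rep_succ_bs h)

/-- The vertices of `G/G_{i+1}` when l(i+1) joins two different blocks: `b_t` disappears.
[cite: Balaban1983Higgs3, (2.16) p.428] -/
theorem reps_succ_of_ne {i : ℕ} (h : i < m) (hne : M.bs i h ≠ M.bt i h) :
    M.reps (i + 1) = (M.reps i).erase (M.bt i h) := by
  ext b
  rw [Finset.mem_erase, M.mem_reps, M.mem_reps, M.rep_succ h]
  constructor
  · intro hb
    have hbt : b ≠ M.bt i h := fun e => M.rho_ne_bt h hne _ (hb.trans e)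
    refine ⟨hbt, ?_⟩
    by_cases h' : M.rep i b = M.bt i h
    · rw [h', M.rho_bt h] at hb
      exfalso
      apply hne
      rw [← h', ← hb, M.rep_bs h]
    · rwa [M.rho_of_ne h h'] at hb
  · rintro ⟨hbt, hb⟩
    rw [hb, M.rho_of_ne h hbt]

/-- The vertices of `G/G_{i+1}` in the loop case: unchanged. [cite: Balaban1983Higgs3, (2.16) p.428] -/
theorem reps_succ_of_loop {i : ℕ} (h : i < m) (heq : M.bs i h = M.bt i h) : M.reps (i + 1) = M.reps i := by
  ext b; rw [M.mem_reps, M.mem_reps, M.rep_succ_of_loop h heq]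

/-- The lines of `G/G_i` (the lines l(i+1), …, l(m) not yet shrunk), as a subset of `Fin m`.
[cite: Balaban1983Higgs3, (2.16) p.428] -/
def remLines (m i : ℕ) : Finset (Fin m) := univ.filter fun l => i ≤ (l : ℕ)

/-- Membership in `remLines`. [cite: Balaban1983Higgs3, (2.16) p.428] -/
theorem mem_remLines {i : ℕ} {l : Fin m} : l ∈ remLines m i ↔ i ≤ (l : ℕ) := by simp [remLines]

/-- `remLines i = {l(i+1)} ∪ remLines (i+1)`. [cite: Balaban1983Higgs3, (2.16) p.428] -/
theorem remLines_eq_insert {i : ℕ} (h : i < m) : remLines m i = insert ⟨i, h⟩ (remLines m (i + 1)) := by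
  ext l
  simp only [Finset.mem_insert, mem_remLines, Fin.ext_iff]
  omega

/-- l(i+1) is not a line of `G/G_{i+1}`. [cite: Balaban1983Higgs3, (2.16) p.428] -/
theorem not_mem_remLines_succ {i : ℕ} (h : i < m) : (⟨i, h⟩ : Fin m) ∉ remLines m (i + 1) := by
  simp [mem_remLines]

/-- `G/G_m` has no lines. [cite: Balaban1983Higgs3, (2.16) p.428] -/
theorem remLines_eq_empty {i : ℕ} (h : m ≤ i) : remLines m i = ∅ := by
  ext l; simp only [mem_remLines, Finset.notMem_empty, iff_false]; have := l.isLt; omega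

/-- `|remLines i| ≤ m`. [cite: Balaban1983Higgs3, (2.16) p.428] -/
theorem card_remLines_le (i : ℕ) : (remLines m i).card ≤ m :=
  (Finset.card_le_univ _).trans (by simp)

/-- The lines of `G/G_i` with an end in the vertex `b`. [cite: Balaban1983Higgs3, (2.14) p.426] -/
def remAt (i : ℕ) (b : V) : Finset (Fin m) :=
  univ.filter fun l => i ≤ (l : ℕ) ∧ (M.rep i (M.src l) = b ∨ M.rep i (M.tgt l) = b)

/-- Membership in `remAt`. [cite: Balaban1983Higgs3, (2.14) p.426] -/
theorem mem_remAt {i : ℕ} {b : V} {l : Fin m} :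
    l ∈ M.remAt i b ↔ i ≤ (l : ℕ) ∧ (M.rep i (M.src l) = b ∨ M.rep i (M.tgt l) = b) := by simp [remAt]

/-- `remAt i b ⊆ remLines i`. [cite: Balaban1983Higgs3, (2.14) p.426] -/
theorem remAt_subset_remLines (i : ℕ) (b : V) : M.remAt i b ⊆ remLines m i := fun _ hl =>
  mem_remLines.2 (M.mem_remAt.1 hl).1

/-- p. 426 [PDF 16]: *"For a vertex v ∈ G(j) let j(v) be a lowest index of the lines with an end in this vertex"* — for
the vertex `b` of `G/G_i` under the assignment `j`; the unit scale `k` if no line of `G/G_i` ends in `b`.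
[cite: Balaban1983Higgs3, (2.14) p.426] -/
def low (i : ℕ) (b : V) (j : Fin m → ℕ) (k : ℕ) : ℕ :=
  (insert k ((M.remAt i b).image j)).min' (Finset.insert_nonempty _ _)

/-- `j(b) ≤ k`. [cite: Balaban1983Higgs3, (2.14) p.426] -/
theorem low_le_k (i : ℕ) (b : V) (j : Fin m → ℕ) (k : ℕ) : M.low i b j k ≤ k :=
  Finset.min'_le _ _ (Finset.mem_insert_self _ _)

/-- `j(b) ≤ j_l` for every line `l` of `G/G_i` at `b`. [cite: Balaban1983Higgs3, (2.14) p.426] -/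
theorem low_le_of_mem {i : ℕ} {b : V} (j : Fin m → ℕ) (k : ℕ) {l : Fin m} (hl : l ∈ M.remAt i b) :
    M.low i b j k ≤ j l :=
  Finset.min'_le _ _ (Finset.mem_insert_of_mem (Finset.mem_image_of_mem j hl))

/-- Characterization of lower bounds for `j(b)`. [cite: Balaban1983Higgs3, (2.14) p.426] -/
theorem le_low_iff {i : ℕ} {b : V} {j : Fin m → ℕ} {k n : ℕ} :
    n ≤ M.low i b j k ↔ n ≤ k ∧ ∀ l ∈ M.remAt i b, n ≤ j l := by
  unfold low
  rw [Finset.le_min'_iff]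
  simp only [Finset.mem_insert, Finset.mem_image, forall_eq_or_imp, forall_exists_index, and_imp,
    forall_apply_eq_imp_iff₂]

/-- `j(b)` is attained: the lowest index of a line at `b`, provided it is `≤ k`. [cite: Balaban1983Higgs3, (2.14) p.426] -/
theorem low_eq_of_forall {i : ℕ} {b : V} {j : Fin m → ℕ} {k : ℕ} {l : Fin m} (hl : l ∈ M.remAt i b) (hk : j l ≤ k)
    (hmin : ∀ l' ∈ M.remAt i b, j l ≤ j l') : M.low i b j k = j l :=
  le_antisymm (M.low_le_of_mem j k hl) (M.le_low_iff.2 ⟨hk, hmin⟩)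

/-- With no line at `b`, `j(b) = k`. [cite: Balaban1983Higgs3, (2.14) p.426] -/
theorem low_eq_k {i : ℕ} {b : V} (j : Fin m → ℕ) (k : ℕ) (h : M.remAt i b = ∅) : M.low i b j k = k :=
  le_antisymm (M.low_le_k i b j k) (M.le_low_iff.2 ⟨le_rfl, by simp [h]⟩)

/-! ## Blocks, their lines, their degrees -/

/-- The block (connected component of `G_i`, or untouched vertex) represented by `b`. [cite: Balaban1983Higgs3, (2.16) p.428] -/
def fiber (i : ℕ) (b : V) : Finset V := univ.filter fun v => M.rep i v = b

/-- Membership in `fiber`. [cite: Balaban1983Higgs3, (2.16) p.428] -/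
theorem mem_fiber {i : ℕ} {b v : V} : v ∈ M.fiber i b ↔ M.rep i v = b := by simp [fiber]

/-- The lines of `G_i` inside the block `b` (both endpoints lie in the block, `rep_src_eq_rep_tgt`).
[cite: Balaban1983Higgs3, (2.16) p.428] -/
def before (i : ℕ) (b : V) : Finset (Fin m) := univ.filter fun l => (l : ℕ) < i ∧ M.rep i (M.src l) = b

/-- Membership in `before`. [cite: Balaban1983Higgs3, (2.16) p.428] -/
theorem mem_before {i : ℕ} {b : V} {l : Fin m} : l ∈ M.before i b ↔ (l : ℕ) < i ∧ M.rep i (M.src l) = b := by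
  simp [before]

/-- The block `b` is a connected component `G_i^{(α)}` of `G_i` (it contains a line), as opposed to an untouched vertex.
[cite: Balaban1983Higgs3, (2.16) p.428] -/
def Nontriv (i : ℕ) (b : V) : Prop := (M.before i b).Nonempty

/-- `Nontriv` is decidable (a finite set is nonempty or not). [cite: Balaban1983Higgs3, (2.16) p.428] -/
instance (i : ℕ) (b : V) : Decidable (M.Nontriv i b) := inferInstanceAs (Decidable (Finset.Nonempty _))

/-- The η-power of a vertex of `G/G_i`: the printed *"proper power of L^{j(v)}η"* for an untouched vertex, none for a
shrunk component (p. 427: *"the graph G₁ becomes a new vertex v₁ with the same external legs as the graph G₁"*).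
[cite: Balaban1983Higgs3, (2.16) p.428] -/
noncomputable def eAt (i : ℕ) (b : V) : ℝ := if M.Nontriv i b then 0 else M.e b

/-- **(2.2)** p. 423 for the component of `G_i` represented by `b`, in Prop. 2.2 generality: `D = Σ_{v ∈ block}(d + e_v)
− d + Σ_{lines of the block} a_l` (the vertex degree `D_G(v)` of (2.1) being `d + e_v +` the leg/differentiation
dimensions, which are collected per line in `a_l`). [cite: Balaban1983Higgs3, (2.2) p.423] -/
noncomputable def D (i : ℕ) (b : V) : ℝ :=
  (∑ v ∈ M.fiber i b, ((M.d : ℝ) + M.e v)) - M.d + ∑ l ∈ M.before i b, M.a l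

/-- **(2.16)** p. 428: the exponent `Σ_α D(G_i^{(α)})` — the sum of the degrees of the connected components of `G_i`.
[cite: Balaban1983Higgs3, (2.16) p.428] -/
noncomputable def Dsum (i : ℕ) : ℝ := ∑ b ∈ (M.reps i).filter (fun b => M.Nontriv i b), M.D i b

/-- Total "mass" of a block: `Σ_{v}(d + e_v) + Σ_{lines} a_l` (so `D = mass − d`). [cite: Balaban1983Higgs3, (2.2) p.423] -/
noncomputable def mass (i : ℕ) (b : V) : ℝ := (∑ v ∈ M.fiber i b, ((M.d : ℝ) + M.e v)) + ∑ l ∈ M.before i b, M.a l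

/-- `D = mass − d`. [cite: Balaban1983Higgs3, (2.2) p.423] -/
theorem D_eq (i : ℕ) (b : V) : M.D i b = M.mass i b - M.d := by unfold D mass; ring

/-- `G₀` has no lines in any block. [cite: Balaban1983Higgs3, (2.16) p.428] -/
theorem before_zero (b : V) : M.before 0 b = ∅ := by ext l; simp [M.mem_before]

/-- `Σ_α D(G₀^{(α)}) = 0` (no components). [cite: Balaban1983Higgs3, (2.16) p.428] -/
theorem Dsum_zero : M.Dsum 0 = 0 := by
  unfold Dsum
  rw [Finset.sum_eq_zero]
  intro b hb
  exact absurd (Finset.mem_filter.1 hb).2 (by simp [Nontriv, M.before_zero])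

/-- An untouched vertex is alone in its block. [cite: Balaban1983Higgs3, (2.16) p.428] -/
theorem eq_of_trivial : ∀ (i : ℕ) (b v : V), M.before i b = ∅ → M.rep i v = b → v = b
  | 0, b, v, _, hv => by simpa using hv
  | i + 1, b, v, hbef, hv => by
      by_cases h : i < m
      · rw [M.rep_succ h] at hv
        by_cases h' : M.rep i v = M.bt i h
        · -- then b = b_s and l(i+1) is a line of the block: contradiction
          rw [h', M.rho_bt h] at hv
          have : (⟨i, h⟩ : Fin m) ∈ M.before (i + 1) b :=
            M.mem_before.2 ⟨Nat.lt_succ_self i, by rw [M.rep_succ_src h, hv]⟩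
          rw [hbef] at this
          exact absurd this (Finset.notMem_empty _)
        · rw [M.rho_of_ne h h'] at hv
          refine eq_of_trivial i b v ?_ hv
          rw [Finset.eq_empty_iff_forall_notMem]
          intro l hl
          have hl' : l ∈ M.before (i + 1) b := by
            rw [M.mem_before] at hl ⊢
            refine ⟨Nat.lt_succ_of_lt hl.1, ?_⟩
            rw [M.rep_succ h, hl.2, M.rho_of_ne h (hv ▸ h')]
          rw [hbef] at hl'
          exact Finset.notMem_empty _ hl'
      · rw [M.rep_succ_of_not_lt h] at hv
        refine eq_of_trivial i b v ?_ hv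
        rw [Finset.eq_empty_iff_forall_notMem]
        intro l hl
        have hl' : l ∈ M.before (i + 1) b := by
          rw [M.mem_before] at hl ⊢
          exact ⟨Nat.lt_succ_of_lt hl.1, by rw [M.rep_succ_of_not_lt h, hl.2]⟩
        rw [hbef] at hl'
        exact Finset.notMem_empty _ hl'

/-- The block of an untouched representative is `{b}`. [cite: Balaban1983Higgs3, (2.16) p.428] -/
theorem fiber_of_trivial {i : ℕ} {b : V} (hb : b ∈ M.reps i) (h : ¬ M.Nontriv i b) : M.fiber i b = {b} := by
  have hbef : M.before i b = ∅ := Finset.not_nonempty_iff_eq_empty.1 h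
  ext v
  rw [M.mem_fiber, Finset.mem_singleton]
  exact ⟨M.eq_of_trivial i b v hbef, fun hv => by rw [hv]; exact M.mem_reps.1 hb⟩

end Model

end Literature.MathematicalPhysics.QuantumFieldTheory.Balaban1983to89.B3Ineq215
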